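import Summits.QuantumAdvantage.AdviceFreeQNC0.RelativeHegedus
import Summits.QuantumAdvantage.AdviceFreeQNC0.ResidueAvoidanceLemmas
import HarnessLib

/-!
# Cell qa-qnc0 (rung F-Q1, route RingFrame, crux α, line `product`): residue walking with the
# relative Hegedűs lemma — the CENTRAL part of a low-degree support is balanced modulo 3, at every density

The window step of HOME/qa-qnc0-p1/TARGET.md §11.3 (the proof of `lowDegAvoidMod3Sparse`, tree file
`LowDegreeResidueAvoidance.lean`) run with the relative robust Hegedűs lemma `relativeHegedus`
(`RelativeHegedus.lean`) in place of Srinivasan's absolute thresholds — so WITHOUT any density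
hypothesis:

* `central_wrong_classes_le` : there are `K > 0`, `c > 0`, `n₀` such that for `n ≥ n₀`, every residue
  `r`, every `d ≤ c·√n` and every `g ∈ lowDeg 𝔽₂ n d`:
  `#{u : g u ≠ 0, |wt u − n/2| ≤ 8√n, wt u ≢ r (mod 3)} ≤ K · #{u : g u ≠ 0, wt u ≡ r (mod 3)}`
  (the window is written `4·wt² + n² ≤ 256n + 4·wt·n`, i.e. `(2wt − n)² ≤ 256n`).

So a support of degree `≤ c√n` can avoid the class `r` only by putting almost all of its points at
Hamming distance `> 8√n` from the middle layer.  Together with a tail lemma ("a fixed fraction of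
every low-degree support is central", which also follows from `relativeHegedus` — masses at least
halve per `q`-step beyond `≈ 100(q/√n)·√n`; qn-lit LIT-MEMO-11 §4(a), NOT in this file) this is
PLDAMS for all densities and all `d ≤ c√n` (rungs 1–3 of TARGET §18).

PROOF.  Choose `q = 2^j` with `75n < q² ≤ 304n`; the window `(2m−n)² ≤ 256n` lies inside
`|2m − n| < 2q`.  A window layer `m ≢ r` has the partner `k ∈ {m − q, m + q}` with `k ≡ r`
(`partner_facts`: `100q < k < n − 100q`, `n/4 ≤ k ≤ 3n/4`, `k` within `2q` of the middle), so
`relativeHegedus` gives `ψ_m ≤ K_rel·ψ_k` and `choose_le_exp_mul_choose` gives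
`C(n,m) ≤ e^{32q²/n}·C(n,k)`; hence `N_m ≤ K_rel·e^{32q²/n}·N_k`, and each `k` is the partner of at
most two layers `m`.  [cite: Srinivasan2023, Lemma 3.1 (via `relativeHegedus`)]
WHAT THIS IS NOT: not PLDAMS (tail lemma missing); constants absurd (`K = 4000·e^{131328}`); no separation.

## References

* S. Srinivasan, *A robust version of Hegedűs's lemma, with applications*, TheoretiCS 2 (2023),
  Lemma 3.1 [Srinivasan2023].
-/

noncomputable section

namespace Summit.QuantumAdvantage.AdviceFreeQNC0

open Finset
open Literature.Computability.MetaComplexity Literature.Computability.MetaComplexity.Smolensky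
open Literature.Computability.MetaComplexity.Hegedus

variable {n : ℕ}

/-- Fibrewise count: the points of the support whose weight satisfies `Q`, summed over layers.
[folklore] -/
private theorem card_filter_ne_zero_pred_eq_sum {F : Type*} [Field F] [DecidableEq F]
    (P : CubeFn F n) (Q : ℕ → Prop) [DecidablePred Q] :
    (univ.filter fun u : Fin n → Bool => P u ≠ 0 ∧ Q (wt u)).card =
      ∑ m ∈ (range (n + 1)).filter (fun m => Q m), ((layer n m).filter fun u => P u ≠ 0).card := by
  rw [card_eq_sum_card_fiberwise (f := fun u : Fin n → Bool => wt u)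
    (t := (range (n + 1)).filter (fun m => Q m)) ?_]
  · refine sum_congr rfl fun m hm => ?_
    rw [mem_filter] at hm
    unfold layer
    rw [filter_filter, filter_filter]
    refine congrArg _ (filter_congr fun u _ => ⟨fun h => ⟨h.2, h.1.1⟩, fun h => ⟨⟨h.2, ?_⟩, h.1⟩⟩)
    rw [h.1]; exact hm.2
  · intro u hu
    have hu' := (mem_filter.1 (Finset.mem_coe.1 hu)).2
    exact Finset.mem_coe.2 (mem_filter.2 ⟨mem_range.2 (Nat.lt_succ_of_le (wt_le_dim u)), hu'.2⟩)

/-- The window `(2m − n)² ≤ 256n` lies inside `|2m − n| < 2q` once `64n < q²`. [folklore] -/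
private theorem window_of_sq {n q m : ℕ} (hq : 64 * n < q * q)
    (hw : 4 * m ^ 2 + n ^ 2 ≤ 256 * n + 4 * m * n) : n < 2 * m + 2 * q ∧ 2 * m < n + 2 * q := by
  constructor
  · by_contra h
    push Not at h
    zify at h hq hw
    nlinarith
  · by_contra h
    push Not at h
    zify at h hq hw
    nlinarith

/-- **Central residue walking (every density).** There are `K > 0`, `c > 0` and `n₀` such that for
all `n ≥ n₀`, all `r`, all `d ≤ c·√n` and every `g ∈ lowDeg 𝔽₂ n d`, the points `u` of the support
with `(2·wt u − n)² ≤ 256n` and `wt u ≢ r (mod 3)` number at most `K` times the points of the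
support with `wt u ≡ r (mod 3)`.  The cell's (qa-qnc0; TARGET §11.3 with `relativeHegedus`).
[cite: Srinivasan2023, Lemma 3.1 (via `relativeHegedus`)] -/
theorem central_wrong_classes_le :
    ∃ K : ℝ, 0 < K ∧ ∃ c : ℝ, 0 < c ∧ ∃ n₀ : ℕ, ∀ n : ℕ, n₀ ≤ n → ∀ r d : ℕ,
      (d : ℝ) ≤ c * Real.sqrt n → ∀ g : CubeFn (ZMod 2) n, g ∈ lowDeg (ZMod 2) n d →
        ((univ.filter fun u : Fin n → Bool =>
            g u ≠ 0 ∧ (4 * wt u ^ 2 + n ^ 2 ≤ 256 * n + 4 * wt u * n ∧ wt u % 3 ≠ r % 3)).card : ℝ) ≤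
          K * ((univ.filter fun u : Fin n → Bool => g u ≠ 0 ∧ wt u % 3 = r % 3).card : ℝ) := by
  classical
  obtain ⟨cH, hcH, nH, hRel⟩ := relativeHegedus
  obtain ⟨K, hK⟩ : ∃ K : ℝ, K = 2 * ((2000 * Real.exp (400 * 1200)) * Real.exp (8 * 4800)) :=
    ⟨_, rfl⟩
  have hKpos : 0 < K := by rw [hK]; positivity
  refine ⟨K, hKpos, 8 * cH, by positivity, max nH (2 ^ 16 * 1200), ?_⟩
  intro n hn r d hd g hg
  have hnH : nH ≤ n := le_trans (le_max_left _ _) hn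
  have hnL : 2 ^ 16 * 1200 ≤ n := le_trans (le_max_right _ _) hn
  have hn0 : 0 < n := by omega
  have hnR : (0 : ℝ) < n := by exact_mod_cast hn0
  /- the scale `q`: a power of two with `75n < q² ≤ 1200n` -/
  obtain ⟨j, hmq, hq2m⟩ := exists_pow_two_btwn (Nat.sqrt (75 * n) + 1) (Nat.succ_pos _)
  obtain ⟨q, hq⟩ : ∃ q : ℕ, q = 2 ^ j := ⟨_, rfl⟩
  rw [← hq] at hmq hq2m
  have hsq1 : 75 * n < (Nat.sqrt (75 * n) + 1) * (Nat.sqrt (75 * n) + 1) := Nat.lt_succ_sqrt _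
  have hsq2 : Nat.sqrt (75 * n) * Nat.sqrt (75 * n) ≤ 75 * n := Nat.sqrt_le _
  have hsq3 : 0 < Nat.sqrt (75 * n) := Nat.sqrt_pos.2 (by omega)
  have hLn_lt : 75 * n < q * q := lt_of_lt_of_le hsq1 (Nat.mul_le_mul hmq.le hmq.le)
  have hqq_le : q * q ≤ 1200 * n := by
    have h3 : q ≤ 4 * Nat.sqrt (75 * n) := by omega
    calc q * q ≤ (4 * Nat.sqrt (75 * n)) * (4 * Nat.sqrt (75 * n)) := Nat.mul_le_mul h3 h3
      _ = 16 * (Nat.sqrt (75 * n) * Nat.sqrt (75 * n)) := by ring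
      _ ≤ 16 * (75 * n) := Nat.mul_le_mul_left _ hsq2
      _ = 1200 * n := by ring
  have h256 : 256 * q ≤ n := by
    have h : (256 * q) * (256 * q) ≤ n * n := by
      calc (256 * q) * (256 * q) = 65536 * (q * q) := by ring
        _ ≤ 65536 * (1200 * n) := Nat.mul_le_mul_left _ hqq_le
        _ = (2 ^ 16 * 1200) * n := by ring
        _ ≤ n * n := Nat.mul_le_mul_right _ hnL
    exact Nat.mul_self_le_mul_self_iff.1 h
  have hq3 : q % 3 ≠ 0 := by rw [hq]; exact two_pow_mod_three_ne_zero j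
  have hqpos : 0 < q := by rw [hq]; positivity
  have hqR : (0 : ℝ) < q := by exact_mod_cast hqpos
  have h75 : 75 * n ≤ q ^ 2 := by rw [sq]; exact hLn_lt.le
  have h64 : 64 * n < q * q := by omega
  have hqq_leR : (q : ℝ) ^ 2 ≤ 1200 * n := by rw [sq]; exact_mod_cast hqq_le
  have hq2n : (q : ℝ) ^ 2 / n ≤ 1200 := by rw [div_le_iff₀ hnR]; exact hqq_leR
  /- degree: `d < c_H · q` -/
  have hdq : (d : ℝ) < cH * q := by
    have hsqrt : 8 * Real.sqrt n < q := by
      have h1 : (8 * Real.sqrt n) ^ 2 = 64 * n := by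
        rw [mul_pow, Real.sq_sqrt hnR.le]; norm_num
      have h2 : (64 : ℝ) * n < (q : ℝ) ^ 2 := by
        rw [sq]; exact_mod_cast h64
      nlinarith [Real.sqrt_nonneg (n : ℝ), hqR]
    calc (d : ℝ) ≤ 8 * cH * Real.sqrt n := hd
      _ = cH * (8 * Real.sqrt n) := by ring
      _ < cH * q := mul_lt_mul_of_pos_left hsqrt hcH
  /- the two constants at this `q` -/
  obtain ⟨Kr, hKr⟩ : ∃ Kr : ℝ, Kr = 2000 * Real.exp (400 * (q : ℝ) ^ 2 / n) := ⟨_, rfl⟩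
  obtain ⟨ρ, hρ⟩ : ∃ ρ : ℝ, ρ = Real.exp (8 * ((2 * q : ℕ) : ℝ) ^ 2 / n) := ⟨_, rfl⟩
  have hKrpos : 0 < Kr := by rw [hKr]; positivity
  have hρpos : 0 < ρ := by rw [hρ]; positivity
  have hKrle : Kr ≤ 2000 * Real.exp (400 * 1200) := by
    rw [hKr]
    refine mul_le_mul_of_nonneg_left (Real.exp_le_exp.2 ?_) (by norm_num)
    rw [mul_div_assoc]
    linarith
  have hρle : ρ ≤ Real.exp (8 * 4800) := by
    rw [hρ]
    refine Real.exp_le_exp.2 ?_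
    push_cast
    rw [mul_div_assoc, show (2 * (q : ℝ)) ^ 2 / n = 4 * ((q : ℝ) ^ 2 / n) by ring]
    linarith
  have hKrρ : 2 * (Kr * ρ) ≤ K := by
    rw [hK]
    exact mul_le_mul_of_nonneg_left (mul_le_mul hKrle hρle hρpos.le (by positivity)) (by norm_num)
  /- layer sums -/
  obtain ⟨N, hN⟩ : ∃ N : ℕ → ℕ, N = fun m => ((layer n m).filter fun u => g u ≠ 0).card :=
    ⟨_, rfl⟩
  have hNm : ∀ m, ((layer n m).filter fun u => g u ≠ 0).card = N m := fun m => by rw [hN]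
  rw [card_filter_ne_zero_pred_eq_sum g
    (fun m => 4 * m ^ 2 + n ^ 2 ≤ 256 * n + 4 * m * n ∧ m % 3 ≠ r % 3),
    card_filter_ne_zero_mod_eq_sum]
  simp only [hNm]
  push_cast
  have hN_eq : ∀ {m}, m ≤ n → (N m : ℝ) = nzFrac g m * n.choose m := fun hm => by
    rw [← hNm]; exact card_filter_layer_eq_nzFrac_mul g hm
  have hN_nonneg : ∀ m, (0 : ℝ) ≤ N m := fun m => Nat.cast_nonneg _
  /- the class-`r` total -/
  obtain ⟨Cr, hCr⟩ : ∃ Cr : ℝ, Cr = ∑ m ∈ (range (n + 1)).filter (fun m => m % 3 = r % 3),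
      (N m : ℝ) := ⟨_, rfl⟩
  rw [← hCr]
  have hCr_nonneg : 0 ≤ Cr := by rw [hCr]; exact sum_nonneg fun m _ => hN_nonneg m
  /- the partner `k(m) ∈ {m - q, m + q}` with `k ≡ r (mod 3)` of a window layer `m ≢ r` -/
  obtain ⟨kf, hkf⟩ : ∃ kf : ℕ → ℕ, kf = fun m => if (m + q) % 3 = r % 3 then m + q else m - q :=
    ⟨_, rfl⟩
  have hk : ∀ m, m < n + 1 → (n < 2 * m + 2 * q ∧ 2 * m < n + 2 * q) → m % 3 ≠ r % 3 →
      kf m % 3 = r % 3 ∧ 100 * q < kf m ∧ kf m + 100 * q < n ∧ n ≤ 4 * kf m ∧ 4 * kf m ≤ 3 * n ∧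
      n / 2 ≤ kf m + 2 * q ∧ kf m ≤ n - n / 2 + 2 * q ∧ kf m ≤ n ∧
      ((kf m = m + q ∧ (m + q) % 3 = r % 3) ∨ (kf m = m - q ∧ q ≤ m ∧ (m + q) % 3 ≠ r % 3)) :=
    fun m hm hw hne => partner_facts h256 hq3 hm hw hne (congrFun hkf m)
  obtain ⟨A, hA⟩ : ∃ A : Finset ℕ, A = ((range (n + 1)).filter
      (fun m => n < 2 * m + 2 * q ∧ 2 * m < n + 2 * q)).filter (fun m => ¬(m % 3 = r % 3)) :=
    ⟨_, rfl⟩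
  have hAmem : ∀ m ∈ A, m < n + 1 ∧ (n < 2 * m + 2 * q ∧ 2 * m < n + 2 * q) ∧ m % 3 ≠ r % 3 := by
    intro m hm
    simp only [hA, mem_filter, mem_range] at hm
    exact ⟨hm.1.1, hm.1.2, hm.2⟩
  /- every window layer `m ≢ r` is dominated by its partner: `N m ≤ Kr·ρ·N (kf m)` -/
  have hdom : ∀ m ∈ A, (N m : ℝ) ≤ Kr * ρ * N (kf m) := by
    intro m hm
    obtain ⟨hm1, hw, hne⟩ := hAmem m hm
    obtain ⟨hk3, hk100, hk100', hk4, hk4', hkw1, hkw2, hkn, hkm⟩ := hk m hm1 hw hne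
    have hrel := hRel n hnH (kf m) q d ⟨j, hq⟩ hk100 hk100' hk4 hk4' h75 hdq g hg
    rw [← hKr] at hrel
    have h16 : 8 * (2 * q) ≤ n := by omega
    have hC := choose_le_exp_mul_choose h16 (by omega : n / 2 ≤ kf m + 2 * q) (by omega) m
    rw [← hρ] at hC
    have hmle : m ≤ n := by omega
    have hψm : nzFrac g m ≤ Kr * nzFrac g (kf m) := by
      rcases hkm with ⟨hke, _⟩ | ⟨hke, hqm, _⟩
      · have e : m = kf m - q := by omega
        calc nzFrac g m = nzFrac g (kf m - q) := congrArg (nzFrac g) e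
          _ ≤ _ := hrel.2
      · have e : m = kf m + q := by omega
        calc nzFrac g m = nzFrac g (kf m + q) := congrArg (nzFrac g) e
          _ ≤ _ := hrel.1
    have hψk0 : 0 ≤ nzFrac g (kf m) := nzFrac_nonneg g (kf m)
    rw [hN_eq hmle, hN_eq hkn]
    calc nzFrac g m * (n.choose m : ℝ)
        ≤ (Kr * nzFrac g (kf m)) * (ρ * n.choose (kf m)) :=
          mul_le_mul hψm hC (Nat.cast_nonneg _) (mul_nonneg hKrpos.le hψk0)
      _ = Kr * ρ * (nzFrac g (kf m) * n.choose (kf m)) := by ring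
  /- each class-`r` layer is the partner of at most two window layers -/
  have hsum_kf : ∑ m ∈ A, (N (kf m) : ℝ) ≤ 2 * Cr := by
    rw [← sum_filter_add_sum_filter_not A (fun m => (m + q) % 3 = r % 3)]
    have hplus : ∑ m ∈ A.filter (fun m => (m + q) % 3 = r % 3), (N (kf m) : ℝ) ≤ Cr := by
      have e : ∀ m ∈ A.filter (fun m => (m + q) % 3 = r % 3), (N (kf m) : ℝ) = N (m + q) := by
        intro m hm
        rw [mem_filter] at hm
        simp only [hkf, if_pos hm.2]
      rw [sum_congr rfl e]
      have hinj : ∀ x ∈ A.filter (fun m => (m + q) % 3 = r % 3),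
          ∀ y ∈ A.filter (fun m => (m + q) % 3 = r % 3), x + q = y + q → x = y := by
        intro x _ y _ h; omega
      rw [← sum_image (f := fun k => (N k : ℝ)) (g := fun m => m + q) hinj, hCr]
      refine sum_le_sum_of_subset_of_nonneg ?_ fun k _ _ => hN_nonneg k
      intro k hk'
      rw [mem_image] at hk'
      obtain ⟨m, hm, rfl⟩ := hk'
      rw [mem_filter] at hm
      obtain ⟨hm1, hw, hne⟩ := hAmem m hm.1
      rw [mem_filter, mem_range]
      exact ⟨by omega, hm.2⟩
    have hminus : ∑ m ∈ A.filter (fun m => ¬((m + q) % 3 = r % 3)), (N (kf m) : ℝ) ≤ Cr := by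
      have e : ∀ m ∈ A.filter (fun m => ¬((m + q) % 3 = r % 3)), (N (kf m) : ℝ) = N (m - q) := by
        intro m hm
        rw [mem_filter] at hm
        simp only [hkf, if_neg hm.2]
      rw [sum_congr rfl e]
      have hinj : ∀ x ∈ A.filter (fun m => ¬((m + q) % 3 = r % 3)),
          ∀ y ∈ A.filter (fun m => ¬((m + q) % 3 = r % 3)), x - q = y - q → x = y := by
        intro x hx y hy h
        obtain ⟨hx1, hwx, _⟩ := hAmem x (mem_filter.1 hx).1
        obtain ⟨hy1, hwy, _⟩ := hAmem y (mem_filter.1 hy).1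
        omega
      rw [← sum_image (f := fun k => (N k : ℝ)) (g := fun m => m - q) hinj, hCr]
      refine sum_le_sum_of_subset_of_nonneg ?_ fun k _ _ => hN_nonneg k
      intro k hk'
      rw [mem_image] at hk'
      obtain ⟨m, hm, rfl⟩ := hk'
      have hm' := mem_filter.1 hm
      obtain ⟨hm1, hw, hne⟩ := hAmem m hm'.1
      obtain ⟨hk3, -, -, -, -, -, -, hkn, hkm⟩ := hk m hm1 hw hne
      rw [mem_filter, mem_range]
      rcases hkm with ⟨_, hc⟩ | ⟨hke, hqm, _⟩
      · exact absurd hc hm'.2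
      · rw [← hke]; exact ⟨by omega, hk3⟩
    linarith
  /- assembly: the `8√n`-window sits inside the `q`-window -/
  have hsub : (range (n + 1)).filter
      (fun m => 4 * m ^ 2 + n ^ 2 ≤ 256 * n + 4 * m * n ∧ m % 3 ≠ r % 3) ⊆ A := by
    intro m hm
    rw [mem_filter] at hm
    rw [hA, mem_filter, mem_filter]
    exact ⟨⟨hm.1, window_of_sq h64 hm.2.1⟩, hm.2.2⟩
  calc ∑ m ∈ (range (n + 1)).filter
          (fun m => 4 * m ^ 2 + n ^ 2 ≤ 256 * n + 4 * m * n ∧ m % 3 ≠ r % 3), (N m : ℝ)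
      ≤ ∑ m ∈ A, (N m : ℝ) := sum_le_sum_of_subset_of_nonneg hsub fun m _ _ => hN_nonneg m
    _ ≤ ∑ m ∈ A, Kr * ρ * (N (kf m) : ℝ) := sum_le_sum hdom
    _ = Kr * ρ * ∑ m ∈ A, (N (kf m) : ℝ) := by rw [mul_sum]
    _ ≤ Kr * ρ * (2 * Cr) := mul_le_mul_of_nonneg_left hsum_kf (by positivity)
    _ = 2 * (Kr * ρ) * Cr := by ring
    _ ≤ K * Cr := mul_le_mul_of_nonneg_right hKrρ hCr_nonneg

end Summit.QuantumAdvantage.AdviceFreeQNC0
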